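import Literature.AlgebraicGeometry.Markman2025.DescentExponentArithmetic

/-!
# Markman 2025 — LEMMA 9.3.3 («the projection `p : G → Ḡ` is an isomorphism»), the group arithmetic of its proof
# (p. 83 L13–14 and the last sentence of (9.3.1)), footnote 24, the first sentence of the proof of LEMMA 9.3.1,
# «The group `G` has exponent `n = d + 1`», and the injectivity mechanism of LEMMA 9.3.4's proof with the remark
# p. 84 L7–8 — AS PRINTED, kernel-checked

E. Markman: [M] *Cycles on abelian 2n-folds of Weil type from secant sheaves on abelian n-folds*,
arXiv:2502.03415 **v2** (2025-06-08), bib `Markman2025SecantWeil` — UNREFEREED PREPRINT. «p. N L m» = PyMuPDF line `m`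
of page `N` of the public v2 PDF (sha256/16 `8155aa33870069b8`), text layer re-extracted at seat lit-w-markman g20
(pub-hsemireg LIT-W, 2026-08-24; sheet `LOCATOR-SHEET-MARKMAN.md` §2 carries §9.3 verbatim, §64–65 this file); p. 83
(the displays and (9.3.1)) and p. 82 L45–55 read BY EYE on renders `r_mar25v2_p83_full.png`, `r_mar25v2_p83_L6-28_zoom.png`,
`r_mar25v2_p82_bottom.png` (`HOME/lit/Markman-renders-litw-markman-g20/`). PRINT-READING PRECISION P-9.3.3 (by eye,
nothing moves): in «`μ^* ∘ (τ_{x₁}, τ_{x₂})_* ∘ μ_*`» the pull-back `μ^*` comes first and the push-forward `μ_*` last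
(`μ^* = (μ⁻¹)_*` for the automorphism `μ`, so the composite is `(μ⁻¹ ∘ τ_{(x₁,x₂)} ∘ μ)_*`, as modelled in
`mu_conj_translation`); the text layer flattens both decorations to «μ∗». This is the
group-theoretic bookkeeping of the EQUIVARIANCE SET-UP of [M] §9.3 (rows M-Mk6 / W1 «derived autoequivalence orbits» of
the LIT-W table): `X = Pic²(C)` for a generic genus-3 curve `C` (principally polarized by `Θ`), `G₁, G₂ ⊂ Pic⁰(C) ≅ X`
subgroups of order `n = d + 1`, `E′ = I_{∪Σ_i} ⊠ I_{∪C_i}` on `X × X`, Orlov's equivalence (twisted by `Θ ⊠ Θ`)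
`Φ̃ : D^b(X × X) → D^b(X × X̂)` conjugating the translation group `G₁ × G₂` to a group `G` of autoequivalences of
`D^b(X × X̂)`, `Ḡ ⊂ X × X̂` its translation part, `μ : X × X → X × X`, `μ(x, y) = (x + y, y)` (§1.3 p. 5 L36, p. 36 L27),
`L_x := Θ ⊗ τ_{x,*}(Θ)⁻¹ ≅ φ_Θ(x)` (p. 82 L52–54).

## What is printed (verbatim, v2)

* LEMMA 9.3.1 (p. 81 L32–36): «A generic `C` admits subgroups `G₁` and `G₂` of `Pic⁰(C)`, such that Assumption 9.2.1
  holds for a `G₁` orbit `{C_i}_{i=1}^n` of translates of `C_p` and a `G₂` orbit `{Σ_i}_{i=1}^n` of translates of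
  `Σ_p`.» Proof, first sentence (p. 81 L37–38): «Assumption 9.2.1(2) is equivalent to the condition that the
  intersection `G₁ ∩ G₂` is trivial, which we assume.» — ASSUMPTION 9.2.1 (2) (p. 73 L3): «The `(d + 1)²` points
  `t_j + s_i`, `1 ≤ i, j ≤ d + 1`, are distinct.», footnote 22 (p. 73 L48): «Recall that `C_i = τ_{s_i}(C_p)` and
  `Σ_j = τ_{t_j}(Σ_p)`.»
* p. 82 L45–46: «Let `Ḡ` be the projection of `G` to `X × X̂`, considered as the group of translation automorphisms
  of `X × X̂`.» LEMMA 9.3.3 (p. 82 L47–48): «If the intersection `G₁ ∩ G₂` does not contain²⁴ an element of order 2,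
  then the projection `p : G → Ḡ` is an isomorphism.» Footnote 24 (p. 82 L55): «This condition is satisfied for `G₁`
  and `G₂` as in Lemma 9.3.1, as then `G₁ ∩ G₂ = {0}`.»
* Proof of 9.3.3, p. 83 L6–14: «Let `(x₁, x₂) ∈ G₁ × G₂`. … We have:
  `μ⁻¹((τ_{x₁}, τ_{x₂})(μ(x, y))) = μ⁻¹(x + y + x₁, y + x₂) = (x + x₁ − x₂, y + x₂)`. Hence,
  `μ^* ∘ (τ_{x₁}, τ_{x₂})_* ∘ μ_* = (τ_{x₁−x₂}, τ_{x₂})_*`.»; p. 83 L44–51: «We get the isomorphism (9.3.1)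
  `Φ̃ ∘ (τ_{x₁}, τ_{x₂})_* ∘ Φ̃⁻¹ ≅ ((π₁^*L_{x₁} ⊗ π₂^*𝒫_{−x₂})⊗) ∘ (τ_{x₁−x₂}, τ_{L_{x₁+x₂}})_*`  The element
  `(τ_{x₁−x₂}, τ_{L_{x₁+x₂}})` of `Ḡ` is the identity, if and only if `x₁ = x₂` and `x₁ + x₂ = 0`, so that `x₁` is a
  point of order 2 of `G₁ ∩ G₂`. □»
* p. 84 L10–11: «The group `G` has exponent `n = d + 1`.» (with §9 opening, p. 69 L8–10: «translates of `C₁` by a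
  cyclic subgroup `G₁` of `Pic⁰(C)` … similarly, for a cyclic subgroup `G₂`», and p. 81 L24–27 «a subgroup `G_i`,
  `i = 1, 2`, of `X` of order `n`»; Lemma 9.3.3: `G ≅ Ḡ ≅ G₁ × G₂` as abstract groups.)
* LEMMA 9.3.4 (p. 83 L53–54): «If `d` is even, then the divisibility `div(det(G))` is relatively prime to the order
  `(d + 1)²` of `G`.» Proof (p. 83 L55 – p. 84 L6): «Let `q : G → Ĝ ⊂ Pic⁰(X × X̂)` be the projection. Both `p : G → Ḡ`
  and `q : G → Ĝ` are isomorphism. The order `(d + 1)²` of `Ĝ` is relatively prime to the rank `8d` of `G` and so the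
  map `G → Pic(X × X̂)`, given by `g ↦ det(G ⊗ q(g)) = det(G) ⊗ q(g)^{rank(G)}` is injective. … We have
  `φ_{det(G)}(p(g)) ≅ φ_{det(G)}(−p(g))⁻¹ := [τ_{p(g),*}(det(G)) ⊗ det(G)⁻¹]⁻¹ ≅ q(g)^{8d}`. It follows that `Ḡ`
  intersects trivially the kernel of `φ_{det(G)}`. Hence, the order of `Ḡ` is relatively prime to the divisibility of
  `det(G)`. □» [sic: «are isomorphism»]; p. 84 L7–8: «Regardless of the parity of `d`, the intersection
  `Ḡ ∩ ker(φ_{det(G)})` consists of the elements of `Ḡ` of order dividing `gcd(d + 1, 8)`, by proof of the above lemma.»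

## The model and what is proved (0 `def`, 0 named fact, 0 sorry; nothing geometric)
`A` = an additive commutative group (the group `X(ℂ)`, or `Pic⁰(C)`); `G₁ G₂ : AddSubgroup A`; `B` = a second
additive group (for `X̂ = Pic⁰(X)`) with an INJECTIVE homomorphism `φ : A →+ B` standing for `x ↦ L_x = φ_Θ(x)`
(`Θ` is a principal polarization, so `φ_Θ` is an isomorphism — BY VALUE; only injectivity is used). By (9.3.1) the
projection `p : G ≅ G₁ × G₂ → X × X̂` is `(x₁, x₂) ↦ (x₁ − x₂, L_{x₁+x₂})`, modelled as
`(x₁, x₂) ↦ (x₁ − x₂, φ(x₁ + x₂))` on `G₁ × G₂`; `Ḡ` is by definition its image. PROVED: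
§A the two displayed computations of p. 83 L13–14 (`mu_inv_tau_mu`, `mu_conj_translation` — `μ⁻¹(u, v) = (u − v, v)`);
§B the last sentence of (9.3.1): `(x₁ − x₂, φ(x₁ + x₂)) = 0 ↔ x₁ = x₂ ∧ x₁ + x₂ = 0` (`translationPart_eq_zero_iff`),
and then `x₁ = x₂ ∈ G₁ ∩ G₂` with `2·x₁ = 0` (`kernel_point_order_two`);
§C LEMMA 9.3.3: no element of order 2 in `G₁ ∩ G₂` ⟹ `p` injective, i.e. a bijection `G → Ḡ = im(p)` (`lemma933`,
`lemma933_bijective_onto_image`); the converse (`p` injective ⟹ no element of order 2 in `G₁ ∩ G₂`) is the model's,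
NOT a printed sentence (`lemma933_converse`, seat remark ×0); footnote 24 (`footnote24`);
§D LEMMA 9.3.1, proof, first sentence: for cosets `s + G₁`, `t + G₂` the sums `(t + h) + (s + g)`, `(g, h) ∈ G₁ × G₂`,
are pairwise distinct iff `G₁ ∩ G₂ = {0}` (`sums_distinct_iff_inter_trivial`);
§E «The group `G` has exponent `n = d + 1`»: `exponent(ℤ/n × ℤ/n) = n` (`exponent_zmod_prod_self`).
§F LEMMA 9.3.4's proof mechanism, with `Ĝ` a finite additive group of order coprime to `r = 8d` (for `d` even:
`DescentExponentArithmetic.coprime_eight_mul_succ_sq_of_even`), `Pic(X × X̂)` an additive group `P`, `ι : Ĝ →+ P` the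
(injective) inclusion and `D = det(G)`: `g ↦ D + r·ι(q g)` is injective (`detTwist_injective`, Mathlib
`Nat.Coprime.nsmul_right_bijective`); with «`φ_{det(G)}(p(g)) ≅ q(g)^{8d}`» BY VALUE, `p(g) ∈ ker φ_{det(G)}` forces
`q(g) = 0` (`q_eq_zero_of_ker`, «`Ḡ` intersects trivially the kernel»); and p. 84 L7–8 for any parity: an element
`x` with `(d+1)·x = 0` and `(8d)·x = 0` has order dividing `gcd(d + 1, 8)` (`addOrderOf_dvd_gcd`, via
`DescentExponentArithmetic.gcd_eight_mul_succ`). The passage from «intersects trivially the kernel» to «the order of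
`Ḡ` is relatively prime to the divisibility» is BY VALUE (structure of `ker φ_{det(G)}`).
BY VALUE (not modelled): Orlov's equivalence, (9.3.1) itself (the line-bundle factor and the computation p. 83
L15–48), the identification `G ≅ G₁ × G₂`, that elements of `G` «are determined by their action on sky-scraper
sheaves and line bundles», the Theorem of the Square, and everything geometric in Lemma 9.3.1's proof after its
first sentence. Nothing here says that any object of the pub-hsemireg cell is semiregular or that HC / HC_CM / HC_AV
is proved; it re-proves no theorem of [M] beyond the displayed group arithmetic.
-/

namespace Literature.AlgebraicGeometry.Markman2025.Lemma933

variable {A : Type*} [AddCommGroup A] {B : Type*} [AddCommGroup B]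

/-! ### §A — p. 83 L13–14: conjugating a translation of `X × X` by `μ(x, y) = (x + y, y)` -/

/-- «`μ⁻¹((τ_{x₁}, τ_{x₂})(μ(x, y))) = μ⁻¹(x + y + x₁, y + x₂) = (x + x₁ − x₂, y + x₂)`» — with `μ(x, y) = (x + y, y)`
and hence `μ⁻¹(u, v) = (u − v, v)`. [cite: Markman2025SecantWeil, proof of Lemma 9.3.3, p. 83 L13] -/
theorem mu_inv_tau_mu (x y x₁ x₂ : A) :
    ((x + y + x₁) - (y + x₂), y + x₂) = (x + x₁ - x₂, y + x₂) := by
  refine Prod.ext ?_ rfl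
  show x + y + x₁ - (y + x₂) = x + x₁ - x₂
  abel

/-- `μ⁻¹(u, v) = (u − v, v)` is indeed the two-sided inverse of `μ(x, y) = (x + y, y)`. [cite: Markman2025SecantWeil,
§1.3 p. 5 L36 and proof of Lemma 9.3.3, p. 83 L13] -/
theorem mu_inv_comp (q : A × A) :
    (fun p : A × A => (p.1 + p.2, p.2)) ((fun p : A × A => (p.1 - p.2, p.2)) q) = q ∧
    (fun p : A × A => (p.1 - p.2, p.2)) ((fun p : A × A => (p.1 + p.2, p.2)) q) = q := by
  constructor <;> ext <;> simp

/-- «Hence, `μ^* ∘ (τ_{x₁}, τ_{x₂})_* ∘ μ_* = (τ_{x₁−x₂}, τ_{x₂})_*`» — at the level of the underlying automorphisms of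
`X × X`: `μ⁻¹ ∘ τ_{(x₁, x₂)} ∘ μ = τ_{(x₁ − x₂, x₂)}`. [cite: Markman2025SecantWeil, proof of Lemma 9.3.3, p. 83 L14] -/
theorem mu_conj_translation (x₁ x₂ : A) :
    (fun p : A × A => (p.1 - p.2, p.2)) ∘ (fun p : A × A => (p.1 + x₁, p.2 + x₂)) ∘
        (fun p : A × A => (p.1 + p.2, p.2)) = fun p : A × A => (p.1 + (x₁ - x₂), p.2 + x₂) := by
  funext p
  simp only [Function.comp_apply]
  refine Prod.ext ?_ rfl
  show p.1 + p.2 + x₁ - (p.2 + x₂) = p.1 + (x₁ - x₂)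
  abel

/-! ### §B — the last sentence of (9.3.1): when is `(τ_{x₁−x₂}, τ_{L_{x₁+x₂}})` the identity? -/

/-- «The element `(τ_{x₁−x₂}, τ_{L_{x₁+x₂}})` of `Ḡ` is the identity, if and only if `x₁ = x₂` and `x₁ + x₂ = 0`» — a
translation of `X × X̂` is the identity iff the translating point `(x₁ − x₂, L_{x₁+x₂})` is zero, and
`L_x = φ_Θ(x)` with `φ_Θ` injective (principal polarization, BY VALUE).
[cite: Markman2025SecantWeil, proof of Lemma 9.3.3, p. 83 L49–50] -/
theorem translationPart_eq_zero_iff (φ : A →+ B) (hφ : Function.Injective φ) (x₁ x₂ : A) :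
    (x₁ - x₂, φ (x₁ + x₂)) = (0 : A × B) ↔ x₁ = x₂ ∧ x₁ + x₂ = 0 := by
  rw [Prod.mk_eq_zero, sub_eq_zero, ← map_zero φ, hφ.eq_iff]

/-- «… so that `x₁` is a point of order 2 of `G₁ ∩ G₂`.» — if `x₁ ∈ G₁`, `x₂ ∈ G₂`, `x₁ = x₂` and `x₁ + x₂ = 0`, then
`x₁ = x₂` lies in `G₁ ∩ G₂` and `2·x₁ = 0` (so `x₁` has order `2` or is `0`).
[cite: Markman2025SecantWeil, proof of Lemma 9.3.3, p. 83 L49–50] -/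
theorem kernel_point_order_two (G₁ G₂ : AddSubgroup A) {x₁ x₂ : A} (h₁ : x₁ ∈ G₁) (h₂ : x₂ ∈ G₂)
    (h : x₁ = x₂ ∧ x₁ + x₂ = 0) : x₁ ∈ G₁ ⊓ G₂ ∧ 2 • x₁ = 0 := by
  obtain ⟨rfl, hsum⟩ := h
  exact ⟨AddSubgroup.mem_inf.mpr ⟨h₁, h₂⟩, by rwa [two_nsmul]⟩

/-! ### §C — LEMMA 9.3.3 and footnote 24 -/

/-- LEMMA 9.3.3 «If the intersection `G₁ ∩ G₂` does not contain an element of order 2, then the projection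
`p : G → Ḡ` is an isomorphism.» — with `G ≅ G₁ × G₂` and `p(x₁, x₂) = (x₁ − x₂, L_{x₁+x₂})` by (9.3.1): if every
`x ∈ G₁ ∩ G₂` with `2·x = 0` is `0`, then `p` is injective (and `Ḡ` is its image by definition, so `p : G → Ḡ` is a
bijection, `lemma933_bijective_onto_image`). Proof as printed: an element of the kernel is `(x₁, x₂)` with
`x₁ = x₂ ∈ G₁ ∩ G₂` of order dividing `2`. [cite: Markman2025SecantWeil, Lemma 9.3.3, p. 82 L47–48; proof p. 83 L49–50] -/
theorem lemma933 (G₁ G₂ : AddSubgroup A) (φ : A →+ B) (hφ : Function.Injective φ)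
    (h2 : ∀ x ∈ G₁, x ∈ G₂ → 2 • x = 0 → x = 0) :
    Function.Injective fun g : G₁ × G₂ => ((g.1 : A) - g.2, φ ((g.1 : A) + g.2)) := by
  rintro ⟨⟨a₁, ha₁⟩, ⟨a₂, ha₂⟩⟩ ⟨⟨b₁, hb₁⟩, ⟨b₂, hb₂⟩⟩ h
  simp only [Prod.mk.injEq] at h
  obtain ⟨hsub, hφs⟩ := h
  have hadd : a₁ + a₂ = b₁ + b₂ := hφ hφs
  -- the difference `(a₁ − b₁, a₂ − b₂) ∈ G₁ × G₂` lies in the kernel of `p`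
  have hu₁ : a₁ - b₁ ∈ G₁ := G₁.sub_mem ha₁ hb₁
  have hu₂ : a₂ - b₂ ∈ G₂ := G₂.sub_mem ha₂ hb₂
  have heq : a₁ - b₁ = a₂ - b₂ := by
    have : (a₁ - a₂) - (b₁ - b₂) = 0 := sub_eq_zero.mpr hsub
    rw [← sub_eq_zero, ← this]; abel
  have hsum : (a₁ - b₁) + (a₂ - b₂) = 0 := by
    have : (a₁ + a₂) - (b₁ + b₂) = 0 := sub_eq_zero.mpr hadd
    rw [← this]; abel
  have hker := kernel_point_order_two G₁ G₂ hu₁ hu₂ ⟨heq, hsum⟩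
  have hzero : a₁ - b₁ = 0 :=
    h2 _ (AddSubgroup.mem_inf.mp hker.1).1 (AddSubgroup.mem_inf.mp hker.1).2 hker.2
  have hzero₂ : a₂ - b₂ = 0 := heq ▸ hzero
  rw [sub_eq_zero] at hzero hzero₂
  subst hzero hzero₂
  rfl

/-- LEMMA 9.3.3, the printed conclusion «`p : G → Ḡ` is an isomorphism» with `Ḡ := im(p)` (p. 82 L45–46 «Let `Ḡ` be
the projection of `G` to `X × X̂`»): `p` co-restricted to its image is a bijection.
[cite: Markman2025SecantWeil, Lemma 9.3.3, p. 82 L45–48] -/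
theorem lemma933_bijective_onto_image (G₁ G₂ : AddSubgroup A) (φ : A →+ B) (hφ : Function.Injective φ)
    (h2 : ∀ x ∈ G₁, x ∈ G₂ → 2 • x = 0 → x = 0) :
    Function.Bijective
      (Set.rangeFactorization fun g : G₁ × G₂ => ((g.1 : A) - g.2, φ ((g.1 : A) + g.2))) :=
  Set.rangeFactorization_bijective.mpr (lemma933 G₁ G₂ φ hφ h2)

/-- The converse direction in the model (a seat remark, NOT a sentence of [M]): if `p` is injective then `G₁ ∩ G₂`
contains no element of order `2` — an `x ∈ G₁ ∩ G₂` with `2·x = 0` gives `(x, x) ↦ (0, L_{2x}) = (0, 0)`.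
[cite: Markman2025SecantWeil, Lemma 9.3.3, p. 82 L47–48 (converse direction: model only)] -/
theorem lemma933_converse (G₁ G₂ : AddSubgroup A) (φ : A →+ B)
    (hinj : Function.Injective fun g : G₁ × G₂ => ((g.1 : A) - g.2, φ ((g.1 : A) + g.2))) :
    ∀ x ∈ G₁, x ∈ G₂ → 2 • x = 0 → x = 0 := by
  intro x hx₁ hx₂ h2x
  have h : (fun g : G₁ × G₂ => ((g.1 : A) - g.2, φ ((g.1 : A) + g.2))) (⟨x, hx₁⟩, ⟨x, hx₂⟩) =
      (fun g : G₁ × G₂ => ((g.1 : A) - g.2, φ ((g.1 : A) + g.2))) (0, 0) := by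
    simp only [sub_self, AddSubgroup.coe_zero, add_zero, map_zero, Prod.mk.injEq, true_and]
    rw [← two_nsmul, h2x, map_zero]
  have := congrArg (fun g : G₁ × G₂ => (g.1 : A)) (hinj h)
  simpa using this

/-- Footnote 24 «This condition is satisfied for `G₁` and `G₂` as in Lemma 9.3.1, as then `G₁ ∩ G₂ = {0}`.» — a trivial
intersection contains no element of order 2, so `p` is injective. [cite: Markman2025SecantWeil, Lemma 9.3.3 fn. 24,
p. 82 L55] -/
theorem footnote24 (G₁ G₂ : AddSubgroup A) (φ : A →+ B) (hφ : Function.Injective φ)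
    (h0 : ∀ x ∈ G₁, x ∈ G₂ → x = 0) :
    Function.Injective fun g : G₁ × G₂ => ((g.1 : A) - g.2, φ ((g.1 : A) + g.2)) :=
  lemma933 G₁ G₂ φ hφ fun x hx₁ hx₂ _ => h0 x hx₁ hx₂

/-- The hypothesis «`G₁ ∩ G₂ = {0}`» of footnote 24 / Lemma 9.3.1 in Mathlib's lattice language (`Disjoint G₁ G₂`).
[cite: Markman2025SecantWeil, Lemma 9.3.3 fn. 24, p. 82 L55] -/
theorem inter_trivial_iff_disjoint (G₁ G₂ : AddSubgroup A) :
    (∀ x ∈ G₁, x ∈ G₂ → x = 0) ↔ Disjoint G₁ G₂ := by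
  rw [AddSubgroup.disjoint_def]

/-! ### §D — LEMMA 9.3.1, proof, first sentence: Assumption 9.2.1 (2) ⟺ `G₁ ∩ G₂ = {0}` -/

/-- «Assumption 9.2.1(2) is equivalent to the condition that the intersection `G₁ ∩ G₂` is trivial» — Assumption
9.2.1 (2): «The `(d + 1)²` points `t_j + s_i`, `1 ≤ i, j ≤ d + 1`, are distinct», where `C_i = τ_{s_i}(C_p)` runs over a
`G₁`-orbit and `Σ_j = τ_{t_j}(Σ_p)` over a `G₂`-orbit (fn. 22), i.e. `s_i ∈ s + G₁`, `t_j ∈ t + G₂`: the sums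
`(t + h) + (s + g)`, `(g, h) ∈ G₁ × G₂`, are pairwise distinct iff `G₁ ∩ G₂ = {0}`.
[cite: Markman2025SecantWeil, proof of Lemma 9.3.1, p. 81 L37–38; Assumption 9.2.1 (2), p. 73 L3 and fn. 22] -/
theorem sums_distinct_iff_inter_trivial (G₁ G₂ : AddSubgroup A) (s t : A) :
    (Function.Injective fun g : G₁ × G₂ => (t + (g.2 : A)) + (s + (g.1 : A))) ↔
      ∀ x ∈ G₁, x ∈ G₂ → x = 0 := by
  constructor
  · intro hinj x hx₁ hx₂
    -- `(x, 0)` and `(0, x)` give the same sum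
    have h : (fun g : G₁ × G₂ => (t + (g.2 : A)) + (s + (g.1 : A))) (⟨x, hx₁⟩, 0) =
        (fun g : G₁ × G₂ => (t + (g.2 : A)) + (s + (g.1 : A))) (0, ⟨x, hx₂⟩) := by
      simp only [AddSubgroup.coe_zero, add_zero]; abel
    have := congrArg (fun g : G₁ × G₂ => (g.2 : A)) (hinj h)
    simpa using this.symm
  · intro h0
    rintro ⟨⟨a₁, ha₁⟩, ⟨a₂, ha₂⟩⟩ ⟨⟨b₁, hb₁⟩, ⟨b₂, hb₂⟩⟩ h
    simp only at h
    have hd : a₁ - b₁ = b₂ - a₂ := by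
      have : (t + a₂ + (s + a₁)) - (t + b₂ + (s + b₁)) = 0 := sub_eq_zero.mpr h
      rw [← sub_eq_zero, ← this]; abel
    have hx : a₁ - b₁ = 0 := h0 _ (G₁.sub_mem ha₁ hb₁) (hd ▸ G₂.sub_mem hb₂ ha₂)
    have hy : b₂ - a₂ = 0 := hd ▸ hx
    rw [sub_eq_zero] at hx hy
    subst hx hy
    rfl

/-! ### §E — «The group `G` has exponent `n = d + 1`» -/

/-- «The group `G` has exponent `n = d + 1`.» — `G ≅ G₁ × G₂` (Lemma 9.3.3) with `G₁, G₂` cyclic of order `n`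
(§9 opening p. 69 L8–10, p. 81 L24–27): `exponent(ℤ/n × ℤ/n) = lcm(n, n) = n`.
[cite: Markman2025SecantWeil, p. 84 L10–11] -/
theorem exponent_zmod_prod_self (n : ℕ) : AddMonoid.exponent (ZMod n × ZMod n) = n := by
  rw [AddMonoid.exponent_prod, ZMod.exponent]
  exact Nat.lcm_self n

/-! ### §F — LEMMA 9.3.4, the injectivity mechanism of its proof, and p. 84 L7–8 -/

section Lemma934

variable {Ĝ : Type*} [AddCommGroup Ĝ] {P : Type*} [AddCommGroup P]

/-- «The order `(d + 1)²` of `Ĝ` is relatively prime to the rank `8d` of `G` and so the map `G → Pic(X × X̂)`, given by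
`g ↦ det(G ⊗ q(g)) = det(G) ⊗ q(g)^{rank(G)}` is injective.» — written additively in `P = Pic(X × X̂)` with
`ι : Ĝ →+ P` the inclusion `Ĝ ⊂ Pic⁰(X × X̂) ⊂ Pic(X × X̂)` and `D = det(G)`: if `ord(Ĝ)` is coprime to `r`, then
`x ↦ D + r·ι(x)` is injective on `Ĝ` (multiplication by `r` is a bijection of `Ĝ`, Mathlib
`Nat.Coprime.nsmul_right_bijective`); pre-composing with the isomorphism `q : G → Ĝ` (BY VALUE) gives the printed map.
For `d` even, `gcd(8d, (d+1)²) = 1` is `DescentExponentArithmetic.coprime_eight_mul_succ_sq_of_even`.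
[cite: Markman2025SecantWeil, proof of Lemma 9.3.4, p. 83 L55–58] -/
theorem detTwist_injective [Finite Ĝ] (ι : Ĝ →+ P) (hι : Function.Injective ι) (D : P) {r : ℕ}
    (hcop : (Nat.card Ĝ).Coprime r) : Function.Injective fun x : Ĝ => D + r • ι x := by
  intro x y h
  have h' : D + r • ι x = D + r • ι y := h
  rw [add_right_inj, ← map_nsmul, ← map_nsmul] at h'
  exact (Nat.Coprime.nsmul_right_bijective hcop).1 (hι h')

/-- «We have `φ_{det(G)}(p(g)) ≅ … ≅ q(g)^{8d}`. It follows that `Ḡ` intersects trivially the kernel of `φ_{det(G)}`.» —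
with the display BY VALUE (`φ(p g) = r·q(g)` in additive notation): if `φ(p g) = 0` then `r·q(g) = 0`, hence `q(g) = 0`
(`r` coprime to `ord Ĝ`), hence `g = 1` in `G` when `q` is injective — i.e. `p(g) = 0` only for the identity.
[cite: Markman2025SecantWeil, proof of Lemma 9.3.4, p. 83 L66 – p. 84 L3] -/
theorem q_eq_zero_of_ker [Finite Ĝ] {G : Type*} (q : G → Ĝ) {r : ℕ} (hcop : (Nat.card Ĝ).Coprime r)
    {g : G} (hker : r • q g = 0) : q g = 0 :=
  (Nat.Coprime.nsmul_right_bijective hcop).1 (by simpa using hker)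

/-- p. 84 L7–8 «Regardless of the parity of `d`, the intersection `Ḡ ∩ ker(φ_{det(G)})` consists of the elements of `Ḡ`
of order dividing `gcd(d + 1, 8)`» — an element killed by `d + 1` (the exponent of `Ḡ ≅ G`) and by `8d` (being in
the kernel, via `q(g)^{8d}`) has order dividing `gcd(8d, d + 1) = gcd(8, d + 1)`
(`DescentExponentArithmetic.gcd_eight_mul_succ`). [cite: Markman2025SecantWeil, §9.3 p. 84 L7–8] -/
theorem addOrderOf_dvd_gcd (d : ℕ) (x : Ĝ) (hn : (d + 1) • x = 0) (hr : (8 * d) • x = 0) :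
    addOrderOf x ∣ Nat.gcd (d + 1) 8 := by
  rw [Nat.gcd_comm, ← gcd_eight_mul_succ]
  exact Nat.dvd_gcd (addOrderOf_dvd_of_nsmul_eq_zero hr) (addOrderOf_dvd_of_nsmul_eq_zero hn)

end Lemma934

end Literature.AlgebraicGeometry.Markman2025.Lemma933
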